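import Summits.QuantumFields.BalabanUV.Beta.GAN24.TransportMarginal
import Summits.QuantumFields.BalabanUV.Beta.GAN24.LinT2ZeroModeStep
import Summits.QuantumFields.BalabanUV.Beta.GAN24.TransversalZeroMode
import Summits.QuantumFields.BalabanUV.Beta.GAN24.Push4Slices
import Summits.QuantumFields.BalabanUV.Beta.GAN24.Push4Bounds

/-!
# `BalabanUV.Beta.GAN24.LinStepCharge` — binder row G-an2-4 / (CONV-C), W-slot road «W3», ROW W3-F3b (T-irr) (gan24-p1-g5 `SKELETON-W3.md` v1.0.2
# §8.3 ∕ (R14-7) ∕ (N-F3b); journal INTENT «W3-TIRR*» l.7944), row-assembly part 1: THE FIRST GENERAL STEP OF THE NORMALISED `T₂`-RECURSION MAPS A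
# JOINTLY `Lc`-COVARIANT TABLE WITH VANISHING FIELD–FIELD ZERO MODE TO A PERIOD-1 COVARIANT TABLE WITH VANISHING FIELD–FIELD ZERO MODE
# — the two hypotheses `hcov`, `hZ` of the (T-irr) core `Push4Irr.push₄_locStencil₂_of_zff` AFTER the first step, at period `1`

NOT IN PRINT; OUR PROOF ATTEMPT ([folklore] bookkeeping over leaf-02's `LinT2ZeroMode(.Step)` (the charge `−Lc^{−4(d+2)}·Z_ff`, (S2c) inside), leaf-16's
`TransversalZeroMode` (linearity ∕ covariance of tables), leaf-17's `Push4Bounds.biLoc_vertex2W_keep` ∕ `Push4Sym.comp_left_lin` ∕ `comp_right_lin`,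
an2's `biLoc_sandwich` ∕ `biLoc_mmRead` ∕ `vertex2OfK_translate`; 0 cited facts, 0 `def`, 0 `def … : Prop`, 0 wall binders).  HONEST FRAMING (cell
contract, verbatim): «discharging `BetaPertH` makes Bałaban's UV stability UNCONDITIONAL — a real constructive-QFT result; it is NOT the continuum limit and
NOT the Clay problem.»  HONEST DEPENDENCY (verbatim): «continuum YM on T⁴ ⇐ BetaPertH ∧ nine spine estimates (0/9 proved); BetaPertH ⇐ (D1) ∧ (D4) ∧
CAP+tail; G-an2-4 gates asym, D1 and NE2/3/4.»  Discharges NOTHING of «T2Shape» ∕ «T2SupRate» ∕ (hW₂, hW₂all); NOT «W-slot closed», NEVER «G-an2-4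
closed»; NOT `BetaPertH`, NOT continuum, NOT Clay.

## What is proved (generic `d`; the literal one-step map `A j X = −(c • mmRead Lc (K̃_j ∘ ½(vertex2OfK K̃_j Lc X κuκ′u′ + vertex2OfK K̃_j Lc X κ′u′κu) ∘ K̃_j))`,
## `K̃_j = KStepUnit Lc j`, the hypothesis shape `hA` of leaf-10's `TransportMarginal`)
* §1 **`locStencil₂_linT2`** — THE NON-SYMMETRISED LINEAR STEP IS A `LocStencil₂` FAMILY in the far form: `Decays K CK mK`, `LocStencil₂ X C δ`, `3δ < mK`
  ⇒ `LocStencil₂ (linT2 K N X) (cLin-constant · C) (δ/4)` (leaf-17's rate-kept `biLoc_vertex2W_keep` ⨾ an2's `biLoc_sandwich` ⨾ `biLoc_mmRead`).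
* §2 `mmRead_lin`, `summable_row_of_decays` ∕ `summable_col_of_decays`, `abs_vertex2OfK_le`, **`step_eq_lin`** (`A j X = (−(c/2)) • (linT2 K̃_j Lc X + swap)` as
  tables), **`step_translate`** (a jointly `Lc`-covariant `X` gives a PERIOD-1 covariant `A j X` on the coarse lattice — leaf-02's `linT2_translate`),
  `step_translate_one` (the same in the `(1:ℕ)`-period currency of `Push4Irr`), **`zmode_one_step_eq_zero`** (`Z_ff X = 0` at period `Lc` ⇒ `zmode 1 (A j X) μ ν (inl α) (inl β) = 0`
  — leaf-02's `zmode_one_linT2_unitKInvStep_step'` for both halves (`zmode_one_swap`), linearity of the inner sums from leaf-16's `inner_add_eq` with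
  the nested summabilities of `Push4Slices`).
Unit `b2b-balaban-gan24-formalise-leaf-12` (G-an2-4 formalisation swarm, leaf prover 12, gen 20; ROW W3-F3b holder), 2026-08-20.
-/

noncomputable section

open Finset
open scoped BigOperators
open Literature.MathematicalPhysics.QuantumFieldTheory
open Literature.MathematicalPhysics.QuantumFieldTheory.Balaban1983to89
open Literature.MathematicalPhysics.QuantumFieldTheory.Balaban1983to89.Beta
open B12Sec2to5 (l1 l1_nonneg)
open ExpKernelCalculus (MKer Decays BiLoc comp Zl Zl_pos Zl_nonneg shiftK summable_exp_shift summable_exp_shift' l1_natSmul l1_sub_symm)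
open OneStepResolventKernel (Fib decays_mono)
open OneStepKernelFamily (colH KInvStep shiftK_KInvStep)
open Summit.QuantumFields.BalabanUV.Beta.HessKerDressedUnits (unitK)
open BalabanCompositeJets (LocStencil₂ LocStencil₂.nonneg)
open BalabanStepJetsSucc (mmRead mmRead_inl_inl mmRead_inr_left mmRead_inr_right biLoc_mmRead)
open SecondOrderResponse (vertex2OfK cBi cBi_nonneg vertexFamily₂_vertex2OfK biLoc_sandwich vertex2OfK_translate)
open AffineAveraging (box toSite)
open Summit.QuantumFields.BalabanUV.Beta.GAN24.CombesThomas (KStepUnit sfStep smStep)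
open Summit.QuantumFields.BalabanUV.Beta.GAN24.Push4 (vertex2W vertex2OfK_eq_vertex2W)
open Summit.QuantumFields.BalabanUV.Beta.GAN24.Push4Bounds (LegDecay legDecay_colH biLoc_vertex2W_keep)
open Summit.QuantumFields.BalabanUV.Beta.GAN24.Push4Sym (comp_left_lin comp_right_lin)
open Summit.QuantumFields.BalabanUV.Beta.GAN24.Push4Iter (BiTab locStencil₂_swapT)
open Summit.QuantumFields.BalabanUV.Beta.GAN24.Push4Slices (abs_tsum_z_le abs_tsum_xz_le abs_sliceSum_le)
open Summit.QuantumFields.BalabanUV.Beta.GAN24.BiStencilZeroMode (Tab zmode zmode_one)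
open Summit.QuantumFields.BalabanUV.Beta.GAN24.LinT2ZeroMode (linT2 linT2_translate zmode_one_swap)
open Summit.QuantumFields.BalabanUV.Beta.GAN24.LinT2ZeroModeStep (shiftK_unitK zmode_one_linT2_unitKInvStep_step')
open Summit.QuantumFields.BalabanUV.Beta.GAN24.TransversalZeroMode (translate_smul translate_add inner_add_eq inner_smul)

namespace Summit.QuantumFields.BalabanUV.Beta.GAN24.LinStepCharge

variable {d : ℕ}

/-! ## §1 The non-symmetrised linear step is a `LocStencil₂` family (far form) -/

/-- [folklore] A bi-localised kernel with a larger constant. -/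
theorem biLoc_of_le {K : MKer (d + 1) (Fib d)} {p q : Fin (d + 1) → ℤ} {C C' δ : ℝ} (h : BiLoc K p q C δ) (hCC : C ≤ C') :
    BiLoc K p q C' δ := fun x y a b =>
  (h x y a b).trans (mul_le_mul_of_nonneg_right hCC (Real.exp_pos _).le)

/-- [folklore] **THE NON-SYMMETRISED LINEAR STEP IS A `LocStencil₂` FAMILY**: for a kernel `K` decaying at rate `mK` with constant `CK`, a blocking
`N ≥ 1` and a table `LocStencil₂ X C δ` with `0 < δ`, `3δ < mK`:
`LocStencil₂ (linT2 K N X) (|Fib|·(|Fib|·(CK·K₁)·Zl(δ/2)·CK)·Zl(δ/4) · C) (δ/4)`, `K₁ = (d+1)·(CK·((d+1)·(CK·Zl(mK−δ)))·Zl(mK−3δ))` — the table's far factor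
`e^{−δ|u′−u|₁}` survives the push of BOTH table legs (leaf-17's rate-kept `biLoc_vertex2W_keep`), the sandwich and the coarse read keep it. -/
theorem locStencil₂_linT2 {K : MKer (d + 1) (Fib d)} {CK mK : ℝ} (hK : Decays K CK mK) (hCK : 0 ≤ CK) {N : ℕ} (hN : 1 ≤ N)
    {X : Tab d} {C δ : ℝ} (hX : LocStencil₂ X C δ) (hδ : 0 < δ) (h3 : 3 * δ < mK) :
    LocStencil₂ (linT2 K N X)
      ((Fintype.card (Fib d) : ℝ) * ((Fintype.card (Fib d) : ℝ) * (CK * ((d + 1 : ℕ) * (CK * ((d + 1 : ℕ) * (CK * C * Zl (d + 1) (mK - δ))) *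
        Zl (d + 1) (mK - 3 * δ)))) * Zl (d + 1) (δ / 2) * CK) * Zl (d + 1) (δ / 4)) (δ / 4) := by
  have hC : 0 ≤ C := hX.nonneg
  have hKδ : Decays K CK δ := decays_mono hK hCK le_rfl (by linarith)
  intro μ y ν y'
  -- the bi-vertex, far form (centres `(N•y, N•y)`, factor `e^{−δ|N•y − N•y′|₁}`)
  have hr : LegDecay (colH K N) N CK mK := legDecay_colH hK
  have hv := biLoc_vertex2W_keep (r := colH K N) hr hX hδ.le h3 μ y ν y'
  rw [← vertex2OfK_eq_vertex2W] at hv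
  -- the sandwich and the coarse read
  have hs := biLoc_sandwich hKδ hCK hδ hv
  have hs' : BiLoc (comp (comp K (vertex2OfK K N X μ y ν y')) K) ((N : ℤ) • y) ((N : ℤ) • y)
      ((Fintype.card (Fib d) : ℝ) * ((Fintype.card (Fib d) : ℝ) * (CK * ((d + 1 : ℕ) * (CK * ((d + 1 : ℕ) * (CK * C * Zl (d + 1) (mK - δ))) *
        Zl (d + 1) (mK - 3 * δ) * Real.exp (-δ * l1 ((N : ℤ) • y - (N : ℤ) • y'))))) * Zl (d + 1) (δ / 2) * CK) * Zl (d + 1) (δ / 4)) (δ / 4) := by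
    intro x z a b
    have h := hs x z a b
    rwa [abs_neg] at h
  have hm := biLoc_mmRead hN hs' (by positivity)
  -- `e^{−δ|N•y − N•y′|₁} ≤ e^{−(δ/4)|y′ − y|₁}`
  have hfar : Real.exp (-δ * l1 ((N : ℤ) • y - (N : ℤ) • y')) ≤ Real.exp (-(δ / 4) * l1 (y' - y)) := by
    rw [Real.exp_le_exp, show (N : ℤ) • y - (N : ℤ) • y' = (N : ℤ) • (y - y') by rw [smul_sub], l1_natSmul, l1_sub_symm y y']
    have hN1 : (1 : ℝ) ≤ N := by exact_mod_cast hN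
    have hl := l1_nonneg (y' - y)
    have h1 : l1 (y' - y) ≤ (N : ℝ) * l1 (y' - y) := le_mul_of_one_le_left hl hN1
    have h2 := mul_le_mul_of_nonneg_left h1 hδ.le
    have h3 := mul_nonneg hδ.le hl
    linarith
  have hZ1 := Zl_nonneg (D := d + 1) (show 0 < mK - δ by linarith)
  have hZ3 := Zl_nonneg (D := d + 1) (show 0 < mK - 3 * δ by linarith)
  have hZ2 := Zl_nonneg (D := d + 1) (half_pos hδ)
  have hZ4 := Zl_nonneg (D := d + 1) (show 0 < δ / 4 by positivity)
  refine biLoc_of_le hm ?_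
  have key : CK * C * Zl (d + 1) (mK - δ) * Zl (d + 1) (mK - 3 * δ) * Real.exp (-δ * l1 ((N : ℤ) • y - (N : ℤ) • y'))
      ≤ CK * C * Zl (d + 1) (mK - δ) * Zl (d + 1) (mK - 3 * δ) * Real.exp (-(δ / 4) * l1 (y' - y)) :=
    mul_le_mul_of_nonneg_left hfar (by positivity)
  calc (Fintype.card (Fib d) : ℝ) * ((Fintype.card (Fib d) : ℝ) * (CK * ((d + 1 : ℕ) * (CK * ((d + 1 : ℕ) * (CK * C * Zl (d + 1) (mK - δ))) *
        Zl (d + 1) (mK - 3 * δ) * Real.exp (-δ * l1 ((N : ℤ) • y - (N : ℤ) • y'))))) * Zl (d + 1) (δ / 2) * CK) * Zl (d + 1) (δ / 4)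
      = ((Fintype.card (Fib d) : ℝ) * (Fintype.card (Fib d) : ℝ) * CK * (d + 1 : ℕ) * CK * (d + 1 : ℕ) * Zl (d + 1) (δ / 2) * CK * Zl (d + 1) (δ / 4)) *
        (CK * C * Zl (d + 1) (mK - δ) * Zl (d + 1) (mK - 3 * δ) * Real.exp (-δ * l1 ((N : ℤ) • y - (N : ℤ) • y'))) := by ring
    _ ≤ ((Fintype.card (Fib d) : ℝ) * (Fintype.card (Fib d) : ℝ) * CK * (d + 1 : ℕ) * CK * (d + 1 : ℕ) * Zl (d + 1) (δ / 2) * CK * Zl (d + 1) (δ / 4)) *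
        (CK * C * Zl (d + 1) (mK - δ) * Zl (d + 1) (mK - 3 * δ) * Real.exp (-(δ / 4) * l1 (y' - y))) := mul_le_mul_of_nonneg_left key (by positivity)
    _ = _ := by ring

/-! ## §2 The literal first step: linear form, period-1 covariance, vanishing field–field charge -/

/-- [folklore] The coarse read is linear: `mmRead M (s • (F + G)) = s • (mmRead M F + mmRead M G)`. -/
theorem mmRead_lin (M : ℕ) (F G : MKer (d + 1) (Fib d)) (s : ℝ) : mmRead M (s • (F + G)) = s • (mmRead M F + mmRead M G) := by
  funext x z a b
  rcases a with α | μ <;> rcases b with β | ν <;> simp [Pi.smul_apply, Pi.add_apply, mul_add]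

/-- [folklore] The rows of a decaying kernel are summable. -/
theorem summable_row_of_decays {K : MKer (d + 1) (Fib d)} {C m : ℝ} (hK : Decays K C m) (hm : 0 < m) (x : Fin (d + 1) → ℤ) (a f : Fib d) :
    Summable fun w => K x w a f :=
  Summable.of_norm_bounded ((summable_exp_shift hm x).mul_left C) (fun w => by rw [Real.norm_eq_abs]; exact hK x w a f)

/-- [folklore] The columns of a decaying kernel are summable. -/
theorem summable_col_of_decays {K : MKer (d + 1) (Fib d)} {C m : ℝ} (hK : Decays K C m) (hm : 0 < m) (z : Fin (d + 1) → ℤ) (f b : Fib d) :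
    Summable fun w => K w z f b :=
  Summable.of_norm_bounded ((summable_exp_shift' hm z).mul_left C) (fun w => by
    rw [Real.norm_eq_abs]; exact (hK w z f b).trans (le_of_eq (by rw [l1_sub_symm])))

/-- [folklore] The bi-vertex of a `LocStencil₂` table through a decaying kernel is uniformly bounded. -/
theorem abs_vertex2OfK_le {K : MKer (d + 1) (Fib d)} {CK m : ℝ} (hK : Decays K CK m) (hCK : 0 ≤ CK) {N : ℕ} {X : Tab d} {C : ℝ}
    (hX : LocStencil₂ X C m) (hm : 0 < m) (μ : Fin (d + 1)) (y : Fin (d + 1) → ℤ) (ν : Fin (d + 1)) (y' : Fin (d + 1) → ℤ)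
    (w z : Fin (d + 1) → ℤ) (f b : Fib d) : |vertex2OfK K N X μ y ν y' w z f b| ≤ cBi d CK C m := by
  have h := vertexFamily₂_vertex2OfK (N := N) hK hCK hX hm μ y ν y' w z f b
  refine h.trans ?_
  have h0 := cBi_nonneg (d := d) hCK hX.nonneg hm
  have : Real.exp (-(m / 8) * (l1 (w - (N : ℤ) • y) + l1 (z - (N : ℤ) • y'))) ≤ 1 := by
    rw [Real.exp_le_one_iff]; nlinarith [l1_nonneg (w - (N : ℤ) • y), l1_nonneg (z - (N : ℤ) • y')]
  nlinarith

section Step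

variable {Lc : ℕ} [NeZero Lc] {CK mK c : ℝ} {A : ℕ → BiTab d → BiTab d}
  (hK : ∀ j, Decays (KStepUnit (d := d) Lc j) CK mK) (hmK : 0 < mK)
  (hA : ∀ j X κ u κ' u', A j X κ u κ' u' = -(c • mmRead Lc (comp (comp (KStepUnit (d := d) Lc j)
    ((1 / 2 : ℝ) • (vertex2OfK (KStepUnit (d := d) Lc j) Lc X κ u κ' u' + vertex2OfK (KStepUnit (d := d) Lc j) Lc X κ' u' κ u)))
    (KStepUnit (d := d) Lc j))))

include hK hmK hA in
/-- [folklore] **THE LITERAL FIRST STEP IN LINEAR FORM**: on a `LocStencil₂` table,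
`A j X = (−(c/2)) • (linT2 K̃_j Lc X + (κ u κ′ u′ ↦ linT2 K̃_j Lc X κ′ u′ κ u))` as tables (the finite-fibre linearity of `comp` on summable rows ∕ columns of
`K̃_j` and bounded bi-vertices — leaf-17's `Push4Sym.comp_left_lin` ∕ `comp_right_lin`). -/
theorem step_eq_lin (j : ℕ) {X : BiTab d} {C δ : ℝ} (hX : LocStencil₂ X C δ) (hδ : 0 < δ) :
    A j X = (-(c / 2)) • (linT2 (KStepUnit (d := d) Lc j) Lc X + fun κ u κ' u' => linT2 (KStepUnit (d := d) Lc j) Lc X κ' u' κ u) := by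
  have hCK : 0 ≤ CK := (hK 0).nonneg (Sum.inl 0)
  set m₀ : ℝ := min mK δ with hm₀
  have hm₀p : 0 < m₀ := lt_min hmK hδ
  have hK₀ : Decays (KStepUnit (d := d) Lc j) CK m₀ := decays_mono (hK j) hCK le_rfl (min_le_left _ _)
  have hX₀ : LocStencil₂ X C m₀ := hX.mono (min_le_right _ _)
  funext κ u κ' u'
  have hb₁ := fun w z f b => abs_vertex2OfK_le (N := Lc) hK₀ hCK hX₀ hm₀p κ u κ' u' w z f b
  have hb₂ := fun w z f b => abs_vertex2OfK_le (N := Lc) hK₀ hCK hX₀ hm₀p κ' u' κ u w z f b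
  have hrow := fun x a f => summable_row_of_decays (hK j) hmK x a f
  have hcol := fun z f b => summable_col_of_decays (hK j) hmK z f b
  have h1 := comp_left_lin (A := KStepUnit (d := d) Lc j) hrow hb₁ hb₂ (1 / 2 : ℝ)
  -- bounds of the two one-sided products (for the right linearity)
  have hM : ∀ (V : MKer (d + 1) (Fib d)) (B : ℝ), (∀ w z f b, |V w z f b| ≤ B) → ∀ x w a f,
      |comp (KStepUnit (d := d) Lc j) V x w a f| ≤ (Fintype.card (Fib d) : ℝ) * (CK * Zl (d + 1) mK * B) := by
    intro V B hV x w a f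
    have hB : 0 ≤ B := (abs_nonneg _).trans (hV 0 0 (Sum.inl 0) (Sum.inl 0))
    unfold comp
    have hpt : ∀ y : Fin (d + 1) → ℤ, |∑ g : Fib d, KStepUnit (d := d) Lc j x y a g * V y w g f| ≤
        (Fintype.card (Fib d) : ℝ) * (CK * B) * Real.exp (-mK * l1 (x - y)) := by
      intro y
      calc |∑ g : Fib d, KStepUnit (d := d) Lc j x y a g * V y w g f| ≤ ∑ g : Fib d, |KStepUnit (d := d) Lc j x y a g * V y w g f| :=
            Finset.abs_sum_le_sum_abs _ _
        _ ≤ ∑ _g : Fib d, CK * Real.exp (-mK * l1 (x - y)) * B := Finset.sum_le_sum fun g _ => by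
            rw [abs_mul]; exact mul_le_mul (hK j x y a g) (hV y w g f) (abs_nonneg _) (by positivity)
        _ = _ := by rw [Finset.sum_const, Finset.card_univ, nsmul_eq_mul]; ring
    have hs := (summable_exp_shift hmK x).mul_left ((Fintype.card (Fib d) : ℝ) * (CK * B))
    have hb := tsum_of_norm_bounded hs.hasSum (fun y => by rw [Real.norm_eq_abs]; exact hpt y)
    rw [Real.norm_eq_abs] at hb
    refine hb.trans (le_of_eq ?_)
    rw [tsum_mul_left, ExpKernelCalculus.tsum_exp_shift]; ring
  have h2 := comp_right_lin (B := KStepUnit (d := d) Lc j) hcol (hM _ _ hb₁) (hM _ _ hb₂) (1 / 2 : ℝ)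
  rw [hA, h1, h2, mmRead_lin]
  simp only [Pi.smul_apply, Pi.add_apply, linT2, smul_smul, neg_smul]
  congr 1
  ring_nf

include hK hmK hA in
/-- [folklore] **THE FIRST STEP'S OUTPUT IS PERIOD-1 COVARIANT ON THE COARSE LATTICE** when the input is jointly `Lc`-covariant (leaf-02's
`linT2_translate` for both halves, `K̃_j`'s block covariance `shiftK_unitK` ⨾ `shiftK_KInvStep`, leaf-16's `translate_add` ∕ `translate_smul`). -/
theorem step_translate (j : ℕ) {X : BiTab d} {C δ : ℝ} (hX : LocStencil₂ X C δ) (hδ : 0 < δ)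
    (hXcov : ∀ κ u κ' u' t, X κ (u + (Lc : ℤ) • t) κ' (u' + (Lc : ℤ) • t) = shiftK (-((Lc : ℤ) • t)) (X κ u κ' u'))
    (μ : Fin (d + 1)) (y : Fin (d + 1) → ℤ) (ν : Fin (d + 1)) (y' t : Fin (d + 1) → ℤ) :
    A j X μ (y + t) ν (y' + t) = shiftK (-t) (A j X μ y ν y') := by
  have hKcov : ∀ t, shiftK (-((Lc : ℤ) • t)) (KStepUnit (d := d) Lc j) = KStepUnit (d := d) Lc j := fun t => by
    rw [KStepUnit, shiftK_unitK, shiftK_KInvStep]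
  have hF₁ : ∀ μ y ν y' t, linT2 (KStepUnit (d := d) Lc j) Lc X μ (y + t) ν (y' + t) = shiftK (-t) (linT2 (KStepUnit (d := d) Lc j) Lc X μ y ν y') :=
    fun μ y ν y' t => linT2_translate hKcov hXcov μ y ν y' t
  have hF₂ : ∀ μ y ν y' t, (fun κ u κ' u' => linT2 (KStepUnit (d := d) Lc j) Lc X κ' u' κ u) μ (y + t) ν (y' + t)
      = shiftK (-t) ((fun κ u κ' u' => linT2 (KStepUnit (d := d) Lc j) Lc X κ' u' κ u) μ y ν y') :=
    fun μ y ν y' t => hF₁ ν y' μ y t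
  rw [step_eq_lin hK hmK hA j hX hδ]
  exact translate_smul (-(c / 2)) (translate_add hF₁ hF₂) μ y ν y' t

include hK hmK hA in
/-- [folklore] The same in `Push4Irr`'s period currency at period `1`: `A j X κ (u + (1:ℕ)•t) κ′ (u′ + (1:ℕ)•t) = shiftK (−((1:ℕ)•t)) (A j X κ u κ′ u′)`. -/
theorem step_translate_one (j : ℕ) {X : BiTab d} {C δ : ℝ} (hX : LocStencil₂ X C δ) (hδ : 0 < δ)
    (hXcov : ∀ κ u κ' u' t, X κ (u + (Lc : ℤ) • t) κ' (u' + (Lc : ℤ) • t) = shiftK (-((Lc : ℤ) • t)) (X κ u κ' u')) :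
    ∀ κ u κ' u' t, A j X κ (u + (((1 : ℕ) : ℕ) : ℤ) • t) κ' (u' + (((1 : ℕ) : ℕ) : ℤ) • t) = shiftK (-((((1 : ℕ) : ℕ) : ℤ) • t)) (A j X κ u κ' u') := by
  intro κ u κ' u' t
  simp only [Nat.cast_one, one_smul]
  exact step_translate hK hmK hA j hX hδ hXcov κ u κ' u' t

include hK hmK hA in
/-- [folklore] **THE FIRST STEP'S OUTPUT HAS VANISHING FIELD–FIELD CHARGE AT PERIOD 1** when the input has vanishing field–field charge at period `Lc`
(and is jointly `Lc`-covariant): `zmode 1 (A j X) μ ν (inl α) (inl β) = (−c/2)·(−Lc^{−4(d+2)})·(Z_ff X μ ν + Z_ff X ν μ) = 0` — leaf-02's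
`zmode_one_linT2_unitKInvStep_step'` (ANY table; the off-diagonal slots die on (S2c)) for the direct half, `zmode_one_swap` for the swapped half, and
the linearity of the inner triple sums (leaf-16's `inner_add_eq` with the nested summabilities of `Push4Slices`). -/
theorem zmode_one_step_eq_zero (j : ℕ) {X : BiTab d} {C δ : ℝ} (hX : LocStencil₂ X C δ) (hδ : 0 < δ)
    (hXcov : ∀ κ u κ' u' t, X κ (u + (Lc : ℤ) • t) κ' (u' + (Lc : ℤ) • t) = shiftK (-((Lc : ℤ) • t)) (X κ u κ' u'))
    (hZ : ∀ κ κ' κ₁ κ₂, zmode Lc X κ κ' (Sum.inl κ₁) (Sum.inl κ₂) = 0) (μ ν α β : Fin (d + 1)) :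
    zmode 1 (A j X) μ ν (Sum.inl α) (Sum.inl β) = 0 := by
  have hCK : 0 ≤ CK := (hK 0).nonneg (Sum.inl 0)
  have hLc : 1 ≤ Lc := Nat.one_le_iff_ne_zero.2 (NeZero.ne Lc)
  -- the two halves as `LocStencil₂` families (for the summabilities of their inner sums)
  set δ₀ : ℝ := min δ (mK / 4) with hδ₀
  have hδ₀p : 0 < δ₀ := lt_min hδ (by positivity)
  have h3 : 3 * δ₀ < mK := by have := min_le_right δ (mK / 4); linarith
  have hX₀ : LocStencil₂ X C δ₀ := hX.mono (min_le_left _ _)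
  have hF₁ := locStencil₂_linT2 (hK j) hCK hLc hX₀ hδ₀p h3
  have hF₂ := locStencil₂_swapT hF₁ (by positivity)
  set F₁ : BiTab d := linT2 (KStepUnit (d := d) Lc j) Lc X with hF₁_def
  set F₂ : BiTab d := fun κ u κ' u' => linT2 (KStepUnit (d := d) Lc j) Lc X κ' u' κ u with hF₂_def
  have hδ4 : 0 < δ₀ / 4 := by positivity
  have hδ12 : 0 < δ₀ / 4 / 3 := by positivity
  -- the charges of the two halves
  have hKcov : ∀ t, shiftK (-((Lc : ℤ) • t)) (KStepUnit (d := d) Lc j) = KStepUnit (d := d) Lc j := fun t => by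
    rw [KStepUnit, shiftK_unitK, shiftK_KInvStep]
  have hz₁ : zmode 1 F₁ μ ν (Sum.inl α) (Sum.inl β) = 0 := by
    rw [hF₁_def, KStepUnit, zmode_one_linT2_unitKInvStep_step' j hX hδ hXcov μ ν α β, hZ, mul_zero]
  have hz₂ : zmode 1 F₂ μ ν (Sum.inl α) (Sum.inl β) = 0 := by
    have hcov₁ : ∀ μ y ν y' t, F₁ μ (y + t) ν (y' + t) = shiftK (-t) (F₁ μ y ν y') :=
      fun μ y ν y' t => linT2_translate hKcov hXcov μ y ν y' t
    rw [hF₂_def, zmode_one_swap F₁ hcov₁, hF₁_def, KStepUnit, zmode_one_linT2_unitKInvStep_step' j hX hδ hXcov ν μ α β, hZ, mul_zero]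
  -- linearity of the inner sums at the base bond `0`
  rw [step_eq_lin hK hmK hA j hX hδ, zmode_one, inner_smul]
  have hadd := inner_add_eq (X := F₁) (Y := F₂) μ 0 ν (Sum.inl α) (Sum.inl β)
    (fun u' x => (abs_tsum_z_le hF₁ hδ4 μ 0 ν u' x _ _).1) (fun u' x => (abs_tsum_z_le hF₂ hδ12 μ 0 ν u' x _ _).1)
    (fun u' => (abs_tsum_xz_le hF₁ hδ4 μ 0 ν u' _ _).1) (fun u' => (abs_tsum_xz_le hF₂ hδ12 μ 0 ν u' _ _).1)
    (abs_sliceSum_le hF₁ hδ4 μ 0 ν α β).1 (abs_sliceSum_le hF₂ hδ12 μ 0 ν α β).1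
  rw [hadd]
  rw [zmode_one] at hz₁ hz₂
  rw [hz₁, hz₂, add_zero, mul_zero]

end Step

end Summit.QuantumFields.BalabanUV.Beta.GAN24.LinStepCharge

end
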